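import Summits.NavierStokesRegularity.NavierStokesRegularity.Theorems.AxisymmetricExtremalityAxisymmetricKatoGlobalReduction
import Summits.NavierStokesRegularity.NavierStokesRegularity.Theorems.AxisymmetricExtremalityAxisymmetricKatoGlobalNoSwirlStratum
import Literature.Analysis.FluidPDE.AxisymmetricReflection
import HarnessLib

/-!
# Strategist s12-g3 (family `s`, gen 3, INDEPENDENT census) — typed companion to `STRATEGY-CENSUS-s12.md`

Crux `AxisymmetricExtremality.AxisymmetricKatoGlobal` (stmt-NavierStokesRegularity-15453).
Evidence only (no stubs, no `sorry`): every `def` is a SIGNATURE quoted in the census, every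
`theorem` is a kernel-checked seam.

* §W  weaker intermediates that could replace the crux in `closes`:
  `NoAxisymMinimalDatum` (threshold instance, `closes_of_noAxisymMinimalDatum`) and the
  route-level `MinimalDatumO2` / `MinimalDatumDihedral → DihedralToO2` replacement, under which the
  with-swirl crux is not needed at all (`summit_of_minimalDatumO2`, `summit_of_dihedral`: an
  `O(2)`-symmetric field is swirl-free, `IsAxisymmetric.hasNoSwirl_of_conj_reflY_eq`, and the
  swirl-free stratum of the crux is LANDED, `axisymmetricKatoGlobal_noSwirl_stratum`).
* §D  the best typed split of the crux itself: `SwirlEvacuatesAxis` (a-priori: SOME modulus of the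
  swirl at the axis up to the final time) ∧ `SmallSwirlRegularity` (criterion: ANY modulus
  suffices) with the assembly `axisymmetricKatoGlobal_of_evacuation_smallSwirl` PROVED from the
  landed stub 1 of line `registered`.
* §S  the strengthening `HolderSwirlAxisModulus` (signature only).
-/

noncomputable section

-- the summit and its single problem share the name (D-0017 nested layout)
set_option linter.dupNamespace false

open Set MeasureTheory Filter Topology Function Metric
open scoped ENNReal NNReal
open Literature.Analysis.FluidPDE Literature.Analysis.FunctionSpaces
open Summit.NavierStokesRegularity.NavierStokesRegularity.Theses.AxisymmetricExtremality
open Summit.NavierStokesRegularity.NavierStokesRegularity.Theorems.AxisymmetricKatoGlobal.Registered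

namespace Summit.NavierStokesRegularity.NavierStokesRegularity.Cruxes.AxisymmetricKatoGlobal.StrategistS12g3

/-! ## Shared vocabulary -/

/-- Clay failure at viscosity `ν` — verbatim the antecedent of `MinimalDatumPFold`. -/
def ClayFails (ν : ℝ) : Prop :=
  ∃ v₀ : EuclideanSpace ℝ (Fin 3) → EuclideanSpace ℝ (Fin 3), ContDiff ℝ (⊤ : ℕ∞) v₀ ∧
    NSWave0.IsDivFree v₀ ∧ HasRapidSpatialDecay v₀ ∧
    ¬ ∃ (u : ℝ → EuclideanSpace ℝ (Fin 3) → EuclideanSpace ℝ (Fin 3))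
        (p : ℝ → EuclideanSpace ℝ (Fin 3) → ℝ),
        IsSmoothOnHalfSpace u ∧ IsSmoothOnHalfSpace p ∧ IsNavierStokesSolution ν 0 v₀ u p ∧
          HasBoundedEnergy u

/-- Mirror equivariance under the meridian reflection `σ (x₀,x₁,x₂) = (x₀,−x₁,x₂)` (`reflY`),
in the form consumed by `IsAxisymmetric.hasNoSwirl_of_conj_reflY_eq`. -/
def IsMirrorSymmetric (u₀ : EuclideanSpace ℝ (Fin 3) → EuclideanSpace ℝ (Fin 3)) : Prop :=
  ∀ x, reflY (u₀ (reflY.symm x)) = u₀ x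

/-! ## §W — weaker intermediates -/

/-- W1 (threshold instance of the crux, exactly what `closes` consumes): no axisymmetric
`Ḣ^{1/2}`-minimal blow-up datum, at any viscosity. -/
def NoAxisymMinimalDatum : Prop :=
  ∀ ν : ℝ, 0 < ν → ∀ (u₀ : EuclideanSpace ℝ (Fin 3) → EuclideanSpace ℝ (Fin 3))
    (g : HomSobolev (EuclideanSpace ℝ (Fin 3)) (EuclideanSpace ℂ (Fin 3)) (1 / 2 : ℝ)),
    IsMinimalBlowupDatum ν u₀ g → IsAxisymmetric u₀ → False

/-- The crux implies its threshold instance (so W1 is weaker-or-equal). -/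
theorem noAxisymMinimalDatum_of_crux (h : AxisymmetricKatoGlobal) : NoAxisymMinimalDatum := by
  intro ν hν u₀ g hmin hax
  obtain ⟨hL3, hrep, hdiv, -, hnot⟩ := hmin
  exact hnot (h ν hν u₀ g hL3 hrep hdiv (fun θ x => hax θ x))

/-- W1 replaces the crux in the route's deciding theorem (same two sister items). -/
theorem closes_of_noAxisymMinimalDatum (h₂ : MinimalDatumPFold) (h₄ : PFoldToAxisymmetric)
    (hW : NoAxisymMinimalDatum) : _root_.NavierStokesRegularity := by
  show Literature.NS.NavierStokesExistenceSmoothR3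
  intro ν hν u₀ hsm hdiv hdec
  by_contra hno
  obtain ⟨u₁, g, hmin, hax⟩ := h₄ ν hν (h₂ ν hν ⟨u₀, hsm, hdiv, hdec, hno⟩)
  exact hW ν hν u₁ g hmin (fun θ x => hax θ x)

/-- W2 (route level): an `O(2)`-symmetric (axisymmetric AND mirror-symmetric) minimal blow-up
datum exists whenever Clay fails. -/
def MinimalDatumO2 : Prop :=
  ∀ ν : ℝ, 0 < ν → ClayFails ν →
    ∃ (u₀ : EuclideanSpace ℝ (Fin 3) → EuclideanSpace ℝ (Fin 3))
      (g : HomSobolev (EuclideanSpace ℝ (Fin 3)) (EuclideanSpace ℂ (Fin 3)) (1 / 2 : ℝ)),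
      IsMinimalBlowupDatum ν u₀ g ∧ IsAxisymmetric u₀ ∧ IsMirrorSymmetric u₀

/-- Under W2 the with-swirl crux is NOT needed: an `O(2)`-symmetric field is swirl-free and the
swirl-free stratum of the crux is a landed theorem. -/
theorem summit_of_minimalDatumO2 (h : MinimalDatumO2) :
    _root_.NavierStokesRegularity := by
  show Literature.NS.NavierStokesExistenceSmoothR3
  intro ν hν u₀ hsm hdiv hdec
  by_contra hno
  obtain ⟨u₁, g, hmin, hax, hrefl⟩ := h ν hν ⟨u₀, hsm, hdiv, hdec, hno⟩
  obtain ⟨hL3, -, hdiv₁, -, hnot⟩ := hmin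
  have hsw : HasNoSwirl u₁ := IsAxisymmetric.hasNoSwirl_of_conj_reflY_eq hax hrefl
  exact hnot
    (Summit.NavierStokesRegularity.NavierStokesRegularity.Theorems.AxisymmetricKatoGlobal.NoSwirlStratum.axisymmetricKatoGlobal_noSwirl_stratum
      ν hν u₁ hL3 hdiv₁ (fun θ x => hax θ x) hsw)

/-- Smith step for the 2-groups `D_{2^k} ⊂ O(2)`: for every `k`, a minimal blow-up datum
equivariant under the rotation by `2π/2^k` about the `x₂`-axis AND under the meridian mirror. -/
def MinimalDatumDihedral : Prop :=
  ∀ ν : ℝ, 0 < ν → ClayFails ν → ∀ k : ℕ,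
    ∃ (u₀ : EuclideanSpace ℝ (Fin 3) → EuclideanSpace ℝ (Fin 3))
      (g : HomSobolev (EuclideanSpace ℝ (Fin 3)) (EuclideanSpace ℂ (Fin 3)) (1 / 2 : ℝ)),
      IsMinimalBlowupDatum ν u₀ g ∧
        (∀ x, u₀ (rotZ (2 * Real.pi / 2 ^ k) x) = rotZ (2 * Real.pi / 2 ^ k) (u₀ x)) ∧
        IsMirrorSymmetric u₀

/-- Compactness upgrade keeping the mirror (the proved `PFoldToAxisymmetric` argument run inside
the closed, `Sim`-compatible mirror-fixed set). -/
def DihedralToO2 : Prop :=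
  ∀ ν : ℝ, 0 < ν →
    (∀ k : ℕ, ∃ (u₀ : EuclideanSpace ℝ (Fin 3) → EuclideanSpace ℝ (Fin 3))
      (g : HomSobolev (EuclideanSpace ℝ (Fin 3)) (EuclideanSpace ℂ (Fin 3)) (1 / 2 : ℝ)),
      IsMinimalBlowupDatum ν u₀ g ∧
        (∀ x, u₀ (rotZ (2 * Real.pi / 2 ^ k) x) = rotZ (2 * Real.pi / 2 ^ k) (u₀ x)) ∧
        IsMirrorSymmetric u₀) →
    ∃ (u₀ : EuclideanSpace ℝ (Fin 3) → EuclideanSpace ℝ (Fin 3))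
      (g : HomSobolev (EuclideanSpace ℝ (Fin 3)) (EuclideanSpace ℂ (Fin 3)) (1 / 2 : ℝ)),
      IsMinimalBlowupDatum ν u₀ g ∧ IsAxisymmetric u₀ ∧ IsMirrorSymmetric u₀

theorem minimalDatumO2_of_dihedral (h₁ : MinimalDatumDihedral) (h₂ : DihedralToO2) :
    MinimalDatumO2 :=
  fun ν hν hc => h₂ ν hν (h₁ ν hν hc)

/-- The dihedral sister items decide the summit WITHOUT `AxisymmetricKatoGlobal`. -/
theorem summit_of_dihedral (h₁ : MinimalDatumDihedral) (h₂ : DihedralToO2) :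
    _root_.NavierStokesRegularity :=
  summit_of_minimalDatumO2 (minimalDatumO2_of_dihedral h₁ h₂)

/-! ## §D — the best typed split of the crux itself (any-modulus a-priori ∧ any-modulus criterion) -/

/-- Piece A (a-priori, OPEN, no tool): along every axisymmetric Kato solution on `[0,T)`, smooth
inside, the swirl `Γ = x₀u₁ − x₁u₀` admits SOME modulus `m → 0` at the axis, uniformly on
`[t₀, T)` — i.e. no swirl concentrates at collapsing scales ("swirl evacuates the axis").
Strictly weaker than the registered `stub_swirlAxisModulus` (`m = C/|log r|³`). -/
def SwirlEvacuatesAxis : Prop :=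
  ∀ ν : ℝ, 0 < ν → ∀ T : ℝ, 0 < T →
    ∀ (u₀ : EuclideanSpace ℝ (Fin 3) → EuclideanSpace ℝ (Fin 3))
      (g : HomSobolev (EuclideanSpace ℝ (Fin 3)) (EuclideanSpace ℂ (Fin 3)) (1 / 2 : ℝ))
      (u : ℝ → EuclideanSpace ℝ (Fin 3) → EuclideanSpace ℝ (Fin 3)),
      g.Represents (Literature.Analysis.FunctionSpaces.EuclideanSpace.complexify ∘ u₀) →
      IsKatoSolutionOn T ν u₀ u → ContDiffOn ℝ (⊤ : ℕ∞) (uncurry u) (Ioo 0 T ×ˢ univ) →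
      (∀ t ∈ Ioo 0 T, IsAxisymmetric (u t)) →
      ∀ t₀ ∈ Ioo 0 T, ∃ m : ℝ → ℝ, Tendsto m (𝓝[>] 0) (𝓝 0) ∧ ∃ δ₀ : ℝ, 0 < δ₀ ∧
        ∀ t ∈ Ico t₀ T, ∀ x : EuclideanSpace ℝ (Fin 3), cylRadius x ≤ δ₀ →
          |swirl (u t) x| ≤ m (cylRadius x)

/-- Piece B (criterion, OPEN — "beyond the reach of existing methods", Lei–Ren 2024, for an
absolute smallness constant; printed only for `m = C|log r|^{-3/2}` (Wei 2016), `C|log r|^{-2}`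
(Lei–Zhang 2017), `C/ log³` (Seregin 2022, the tree's discharged fact)): ANY modulus of the swirl
at the axis on a final time slab forces boundedness near every point of the final time slice. -/
def SmallSwirlRegularity : Prop :=
  ∀ ν : ℝ, 0 < ν → ∀ T : ℝ, 0 < T →
    ∀ (u₀ : EuclideanSpace ℝ (Fin 3) → EuclideanSpace ℝ (Fin 3))
      (u : ℝ → EuclideanSpace ℝ (Fin 3) → EuclideanSpace ℝ (Fin 3)),
      IsKatoSolutionOn T ν u₀ u → ContDiffOn ℝ (⊤ : ℕ∞) (uncurry u) (Ioo 0 T ×ˢ univ) →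
      (∀ t ∈ Ioo 0 T, IsAxisymmetric (u t)) →
      (∃ t₀ ∈ Ioo 0 T, ∃ m : ℝ → ℝ, Tendsto m (𝓝[>] 0) (𝓝 0) ∧ ∃ δ₀ : ℝ, 0 < δ₀ ∧
        ∀ t ∈ Ico t₀ T, ∀ x : EuclideanSpace ℝ (Fin 3), cylRadius x ≤ δ₀ →
          |swirl (u t) x| ≤ m (cylRadius x)) →
      ∀ x₀ : EuclideanSpace ℝ (Fin 3), IsBoundedNearTop u T x₀

/-- Assembly of §D, PROVED (landed stub 1 of line `registered` + finiteness of the `L^∞` norm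
on a bounded backward cylinder): A ∧ B ⇒ the crux. -/
theorem axisymmetricKatoGlobal_of_evacuation_smallSwirl (hA : SwirlEvacuatesAxis)
    (hB : SmallSwirlRegularity) : AxisymmetricKatoGlobal := by
  intro ν hν u₀ g hL3 hrep hdiv hax
  have hax' : IsAxisymmetric u₀ := fun θ x => hax θ x
  by_contra hng
  obtain ⟨T, hT, xs, u, hK, hsm, haxi, hsing⟩ :=
    stub_katoAxisymSingularPoint ν hν u₀ hL3 hdiv hax' hng
  have ht₀ : T / 2 ∈ Ioo 0 T := ⟨by linarith, by linarith⟩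
  obtain ⟨m, hm, δ₀, hδ₀, hmod⟩ := hA ν hν T hT u₀ g u hrep hK hsm haxi (T / 2) ht₀
  obtain ⟨r, hr, K, hbd⟩ := hB ν hν T hT u₀ u hK hsm haxi ⟨T / 2, ht₀, m, hm, δ₀, hδ₀, hmod⟩ xs
  exact absurd (hsing r hr) (eLpNorm_parabolicCylinder_lt_top_of_forall_le hbd).ne

/-! ## §S — strengthening (signature only) -/

/-- S⁺: a Hölder modulus of the swirl at the axis a priori up to the final time. Strictly
stronger than `stub_swirlAxisModulus`; the added rigidity buys nothing for THIS step (no a-priori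
modulus of any strength is known at a potential singular time). -/
def HolderSwirlAxisModulus : Prop :=
  ∀ ν : ℝ, 0 < ν → ∀ T : ℝ, 0 < T →
    ∀ (u₀ : EuclideanSpace ℝ (Fin 3) → EuclideanSpace ℝ (Fin 3))
      (g : HomSobolev (EuclideanSpace ℝ (Fin 3)) (EuclideanSpace ℂ (Fin 3)) (1 / 2 : ℝ))
      (u : ℝ → EuclideanSpace ℝ (Fin 3) → EuclideanSpace ℝ (Fin 3)),
      g.Represents (Literature.Analysis.FunctionSpaces.EuclideanSpace.complexify ∘ u₀) →
      IsKatoSolutionOn T ν u₀ u → ContDiffOn ℝ (⊤ : ℕ∞) (uncurry u) (Ioo 0 T ×ˢ univ) →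
      (∀ t ∈ Ioo 0 T, IsAxisymmetric (u t)) →
      ∀ t₀ ∈ Ioo 0 T, ∃ C α δ₀ : ℝ, 0 < α ∧ 0 < δ₀ ∧ δ₀ < 1 ∧
        ∀ t ∈ Ico t₀ T, ∀ x : EuclideanSpace ℝ (Fin 3), cylRadius x ≤ δ₀ →
          |swirl (u t) x| ≤ C * cylRadius x ^ α

end Summit.NavierStokesRegularity.NavierStokesRegularity.Cruxes.AxisymmetricKatoGlobal.StrategistS12g3

end
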